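import Literature.Computability.MetaComplexity.FregeVerifierBricks
import HarnessLib

/-!
# A string-level verifier for `textbookFrege` proofs, IV: the polynomial-time machine

Last part of the discharge of
`Literature.Computability.Complexity.textbookFrege_hasPolyTimeVerifier` (Cook–Reckhow 1979,
closing remark of §1: Frege proofs, written as strings, are checkable in polynomial time). The
model checker `FregeVerifier.run` of `FregeVerifierModel.lean` is realised as the tree's fold
brick `Brick.foldFn` (`ListFoldBricks.lean`: fold an `FP` step of bounded growth over the items
`Brick.decNil c` of the certificate `c`, in `|⟨w, c⟩|` clocked rounds) of one `FP` step function
`stepA` on step arguments `⟨⟨w, c⟩, ⟨item, ⟨[ok], ⟨encList lines, encList pool⟩⟩⟩⟩` (`encV`):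

* `stepA` dispatches on the kind tag of the item (`iteFn` chain over the `15` tags, `chain`) to
  the update of that kind (pool updates `updPool`, rule updates `updLine`, failure `updFail`),
  each a fan-out of projections, membership tests `memFn`, string instantiations `fillFn` and
  concatenations; `stepA_encV`: **the step is the step of the model**;
* `foldGrowth_stepA`: the step returns an accumulator at most `4 |item| + 154` longer than the
  old one, on *every* input (the consumed item pays for the strings it adds), which is the growth
  hypothesis of `Brick.foldFn_mem_FP`; `foldl_stepA`: folding the step runs the model;
* `checkerF`, `fregeVerdictF`, `verifier`: run the fold on the input pair `⟨w, c⟩` and accept iff `ok`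
  and the most recent line equals the code carried by `w`; `isPolyTimeVerifier_verifier`,
  `verifier_sound` (from `isTautology_of_run`), `verifier_complete` (from
  `exists_certificate`).

## References

* S. A. Cook, R. A. Reckhow, *The relative efficiency of propositional proof systems*,
  J. Symbolic Logic 44 (1979) 36–50, §1 (closing remark, pp. 39–40; p. 37).
* S. Arora, B. Barak, *Computational Complexity: A Modern Approach*, CUP 2009, §1.3.
-/

namespace Literature.Computability.MetaComplexity

open _root_.Computability Complexity Complexity.Brick Polynomial

namespace FregeVerifier

/-! ### Projections of the step argument -/

/-- The current item. [folklore] -/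
def itemF : List Bool → List Bool := nthF 1
/-- The kind tag of the item. [folklore] -/
def kindF : List Bool → List Bool := nthF 0 ∘ itemF
/-- The payload record `⟨a, ⟨b, ⟨c, ε⟩⟩⟩` of the item. [folklore] -/
def srecF : List Bool → List Bool := sndF ∘ itemF
/-- Payload `a`. [folklore] -/
def aF : List Bool → List Bool := nthF 0 ∘ srecF
/-- Payload `b`. [folklore] -/
def bF : List Bool → List Bool := nthF 1 ∘ srecF
/-- Payload `c`. [folklore] -/
def cF : List Bool → List Bool := nthF 2 ∘ srecF
/-- The normalised verdict flag `[ok]`. [folklore] -/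
noncomputable def flN : List Bool → List Bool := eqConstFn (nthF 2) [true]
/-- Membership of a computed string in the pool. [folklore] -/
noncomputable def memP (f : List Bool → List Bool) : List Bool → List Bool := memFn ∘ fanoutFn f (sndPow 3)
/-- Membership of a computed string among the lines. [folklore] -/
noncomputable def memL (f : List Bool → List Bool) : List Bool → List Bool := memFn ∘ fanoutFn f (nthF 3)

/-- `itemF ∈ FP`. [folklore] -/
theorem itemF_mem_FP : itemF ∈ FP := nthF_mem_FP 1
/-- `kindF ∈ FP`. [folklore] -/
theorem kindF_mem_FP : kindF ∈ FP := comp_mem_FP (nthF_mem_FP 0) itemF_mem_FP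
/-- `srecF ∈ FP`. [folklore] -/
theorem srecF_mem_FP : srecF ∈ FP := comp_mem_FP sndF_mem_FP itemF_mem_FP
/-- `aF ∈ FP`. [folklore] -/
theorem aF_mem_FP : aF ∈ FP := comp_mem_FP (nthF_mem_FP 0) srecF_mem_FP
/-- `bF ∈ FP`. [folklore] -/
theorem bF_mem_FP : bF ∈ FP := comp_mem_FP (nthF_mem_FP 1) srecF_mem_FP
/-- `cF ∈ FP`. [folklore] -/
theorem cF_mem_FP : cF ∈ FP := comp_mem_FP (nthF_mem_FP 2) srecF_mem_FP
/-- `flN ∈ FP`. [folklore] -/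
theorem flN_mem_FP : flN ∈ FP := eqConstFn_mem_FP (nthF_mem_FP 2) _
/-- `memP f ∈ FP`. [folklore] -/
theorem memP_mem_FP {f : List Bool → List Bool} (hf : f ∈ FP) : memP f ∈ FP :=
  comp_mem_FP memFn_mem_FP (fanoutFn_mem_FP hf (sndPow_mem_FP 3))
/-- `memL f ∈ FP`. [folklore] -/
theorem memL_mem_FP {f : List Bool → List Bool} (hf : f ∈ FP) : memL f ∈ FP :=
  comp_mem_FP memFn_mem_FP (fanoutFn_mem_FP hf (nthF_mem_FP 3))
/-- `flN` is one-bit. [folklore] -/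
theorem oneBit_flN : OneBit flN := oneBit_eqConstFn _ _
/-- `memP f` is one-bit. [folklore] -/
theorem oneBit_memP (f : List Bool → List Bool) : OneBit (memP f) := oneBit_memFn.comp _
/-- `memL f` is one-bit. [folklore] -/
theorem oneBit_memL (f : List Bool → List Bool) : OneBit (memL f) := oneBit_memFn.comp _

section Values

variable (x a : List Bool) (st : MState)

/-- `itemF` on the step argument. [folklore] -/
@[simp] theorem itemF_encV : itemF (encV x a st) = a := by simp [itemF]
/-- `kindF` on the step argument. [folklore] -/
@[simp] theorem kindF_encV : kindF (encV x a st) = nthF 0 a := by simp [kindF, itemF]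
/-- `aF` on the step argument. [folklore] -/
@[simp] theorem aF_encV : aF (encV x a st) = nthF 1 a := by
  simp only [aF, srecF, itemF, Function.comp_apply, nthF1_encV]; rfl
/-- `bF` on the step argument. [folklore] -/
@[simp] theorem bF_encV : bF (encV x a st) = nthF 2 a := by
  simp only [bF, srecF, itemF, Function.comp_apply, nthF1_encV]; rfl
/-- `cF` on the step argument. [folklore] -/
@[simp] theorem cF_encV : cF (encV x a st) = nthF 3 a := by
  simp only [cF, srecF, itemF, Function.comp_apply, nthF1_encV]; rfl
/-- `flN` on the step argument. [folklore] -/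
@[simp] theorem flN_encV : flN (encV x a st) = [st.ok] := eqConstFn_true_bit _ _ _ (by simp)
/-- `memP` on the step argument. [folklore] -/
@[simp] theorem memP_encV (f : List Bool → List Bool) :
    memP f (encV x a st) = [decide (f (encV x a st) ∈ st.pool)] := by
  simp [memP, memFn_boolPair_encList]
/-- `memL` on the step argument. [folklore] -/
@[simp] theorem memL_encV (f : List Bool → List Bool) :
    memL f (encV x a st) = [decide (f (encV x a st) ∈ st.lines)] := by
  simp [memL, memFn_boolPair_encList]
/-- `fillFn T ∘ srecF` on the step argument is string instantiation by the payloads. [folklore] -/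
@[simp] theorem fillFn_srecF_encV (T : PropForm ℕ) :
    (fillFn T ∘ srecF) (encV x a st) = sfill (sv (nthF 1 a) (nthF 2 a) (nthF 3 a)) T := by
  simp only [Function.comp_apply, fillFn_apply, srecF, itemF, nthF1_encV]; rfl

end Values

/-! ### The updates of the accumulator -/

/-- Pool update: AND the check into the flag, push `out` onto the pool. [folklore] -/
noncomputable def updPool (ok out : List Bool → List Bool) : List Bool → List Bool :=
  fanoutFn (andFn flN ok) (fanoutFn (nthF 3) (fanoutFn out (sndPow 3)))

/-- Line update: AND the check into the flag, push `out` onto the lines. [folklore] -/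
noncomputable def updLine (ok out : List Bool → List Bool) : List Bool → List Bool :=
  fanoutFn (andFn flN ok) (fanoutFn (fanoutFn out (nthF 3)) (sndPow 3))

/-- Failure update: clear the flag. [folklore] -/
noncomputable def updFail : List Bool → List Bool :=
  fanoutFn (fun _ => [false]) (fanoutFn (nthF 3) (sndPow 3))

/-- `updPool ok out ∈ FP`. [folklore] -/
theorem updPool_mem_FP {ok out : List Bool → List Bool} (hok : ok ∈ FP) (hout : out ∈ FP) :
    updPool ok out ∈ FP :=
  fanoutFn_mem_FP (andFn_mem_FP flN_mem_FP hok)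
    (fanoutFn_mem_FP (nthF_mem_FP 3) (fanoutFn_mem_FP hout (sndPow_mem_FP 3)))
/-- `updLine ok out ∈ FP`. [folklore] -/
theorem updLine_mem_FP {ok out : List Bool → List Bool} (hok : ok ∈ FP) (hout : out ∈ FP) :
    updLine ok out ∈ FP :=
  fanoutFn_mem_FP (andFn_mem_FP flN_mem_FP hok)
    (fanoutFn_mem_FP (fanoutFn_mem_FP hout (nthF_mem_FP 3)) (sndPow_mem_FP 3))
/-- `updFail ∈ FP`. [folklore] -/
theorem updFail_mem_FP : updFail ∈ FP :=
  fanoutFn_mem_FP (const_mem_FP _) (fanoutFn_mem_FP (nthF_mem_FP 3) (sndPow_mem_FP 3))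

/-- Value of a pool update. [folklore] -/
theorem updPool_encV {ok out : List Bool → List Bool} (x a : List Bool) (st : MState) {β : Bool}
    (hok : ok (encV x a st) = [β]) :
    updPool ok out (encV x a st) = encA ⟨st.ok && β, st.lines, out (encV x a st) :: st.pool⟩ := by
  have h := andFn_apply (flN_encV x a st) hok
  simp only [updPool, fanoutFn_apply, h, nthF3_encV, sndPow3_encV]
  simp [encA, encList]

/-- Value of a line update. [folklore] -/
theorem updLine_encV {ok out : List Bool → List Bool} (x a : List Bool) (st : MState) {β : Bool}
    (hok : ok (encV x a st) = [β]) :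
    updLine ok out (encV x a st) = encA ⟨st.ok && β, out (encV x a st) :: st.lines, st.pool⟩ := by
  have h := andFn_apply (flN_encV x a st) hok
  simp only [updLine, fanoutFn_apply, h, nthF3_encV, sndPow3_encV]
  simp [encA, encList]

/-- Value of the failure update. [folklore] -/
theorem updFail_encV (x a : List Bool) (st : MState) :
    updFail (encV x a st) = encA ⟨false, st.lines, st.pool⟩ := by
  simp [updFail, encA]

/-! ### Checks and outputs of the kinds -/

/-- The check of pool kind `n`. [folklore] -/
noncomputable def okP : ℕ → (List Bool → List Bool)
  | 0 => fun _ => [true]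
  | 1 => fun _ => [true]
  | 2 => fun _ => [true]
  | 3 => memP aF
  | _ + 4 => andFn (memP aF) (memP bF)

/-- The output of pool kind `n`. [folklore] -/
noncomputable def outP : ℕ → (List Bool → List Bool)
  | 0 => List.cons false ∘ List.cons false ∘ fanoutFn aF (fun _ => [])
  | 1 => fun _ => [false, true, true]
  | 2 => fun _ => [false, true, false]
  | 3 => List.cons true ∘ List.cons false ∘ aF
  | 4 => List.cons true ∘ List.cons true ∘ List.cons false ∘ appendFn ∘ fanoutFn aF bF
  | _ + 5 => List.cons true ∘ List.cons true ∘ List.cons true ∘ appendFn ∘ fanoutFn aF bF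

/-- The premise checks of a rule: every instantiated premise is among the lines. [folklore] -/
noncomputable def premsFn : List (PropForm ℕ) → (List Bool → List Bool)
  | [] => fun _ => [true]
  | p :: ps => andFn (memL (fillFn p ∘ srecF)) (premsFn ps)

/-- The check of a rule item. [folklore] -/
noncomputable def okR (r : FregeRule) : List Bool → List Bool :=
  andFn (premsFn r.premises) (andFn (memP aF) (andFn (memP bF) (memP cF)))

/-- The output of a rule item: the instantiated conclusion. [folklore] -/
noncomputable def outR (r : FregeRule) : List Bool → List Bool := fillFn r.conclusion ∘ srecF

/-- `okP n ∈ FP`. [folklore] -/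
theorem okP_mem_FP : ∀ n, okP n ∈ FP
  | 0 => const_mem_FP _
  | 1 => const_mem_FP _
  | 2 => const_mem_FP _
  | 3 => memP_mem_FP aF_mem_FP
  | _ + 4 => andFn_mem_FP (memP_mem_FP aF_mem_FP) (memP_mem_FP bF_mem_FP)
/-- `outP n ∈ FP`. [folklore] -/
theorem outP_mem_FP : ∀ n, outP n ∈ FP
  | 0 => show (List.cons false ∘ List.cons false ∘ fanoutFn aF (fun _ => [])) ∈ FP from
      comp_mem_FP (cons_mem_FP _) (comp_mem_FP (cons_mem_FP _) (fanoutFn_mem_FP aF_mem_FP (const_mem_FP _)))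
  | 1 => const_mem_FP _
  | 2 => const_mem_FP _
  | 3 => show (List.cons true ∘ List.cons false ∘ aF) ∈ FP from
      comp_mem_FP (cons_mem_FP _) (comp_mem_FP (cons_mem_FP _) aF_mem_FP)
  | 4 => show (List.cons true ∘ List.cons true ∘ List.cons false ∘ appendFn ∘ fanoutFn aF bF) ∈ FP from
      comp_mem_FP (cons_mem_FP _) (comp_mem_FP (cons_mem_FP _) (comp_mem_FP (cons_mem_FP _)
        (comp_mem_FP appendFn_mem_FP (fanoutFn_mem_FP aF_mem_FP bF_mem_FP))))
  | _ + 5 => show (List.cons true ∘ List.cons true ∘ List.cons true ∘ appendFn ∘ fanoutFn aF bF) ∈ FP from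
      comp_mem_FP (cons_mem_FP _) (comp_mem_FP (cons_mem_FP _) (comp_mem_FP (cons_mem_FP _)
        (comp_mem_FP appendFn_mem_FP (fanoutFn_mem_FP aF_mem_FP bF_mem_FP))))
/-- `premsFn ps ∈ FP`. [folklore] -/
theorem premsFn_mem_FP : ∀ ps, premsFn ps ∈ FP
  | [] => const_mem_FP _
  | p :: ps => andFn_mem_FP (memL_mem_FP (comp_mem_FP (fillFn_mem_FP p) srecF_mem_FP)) (premsFn_mem_FP ps)
/-- `okR r ∈ FP`. [folklore] -/
theorem okR_mem_FP (r : FregeRule) : okR r ∈ FP :=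
  andFn_mem_FP (premsFn_mem_FP _) (andFn_mem_FP (memP_mem_FP aF_mem_FP)
    (andFn_mem_FP (memP_mem_FP bF_mem_FP) (memP_mem_FP cF_mem_FP)))
/-- `outR r ∈ FP`. [folklore] -/
theorem outR_mem_FP (r : FregeRule) : outR r ∈ FP := comp_mem_FP (fillFn_mem_FP _) srecF_mem_FP

/-- `okP n` is one-bit. [folklore] -/
theorem oneBit_okP : ∀ n, OneBit (okP n)
  | 0 => oneBit_const _
  | 1 => oneBit_const _
  | 2 => oneBit_const _
  | 3 => oneBit_memP _
  | _ + 4 => oneBit_andFn (oneBit_memP _) (oneBit_memP _)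
/-- `premsFn ps` is one-bit. [folklore] -/
theorem oneBit_premsFn : ∀ ps, OneBit (premsFn ps)
  | [] => oneBit_const _
  | _ :: ps => oneBit_andFn (oneBit_memL _) (oneBit_premsFn ps)
/-- `okR r` is one-bit. [folklore] -/
theorem oneBit_okR (r : FregeRule) : OneBit (okR r) :=
  oneBit_andFn (oneBit_premsFn _) (oneBit_andFn (oneBit_memP _) (oneBit_andFn (oneBit_memP _) (oneBit_memP _)))

/-- `okP n` computes `poolOk n`. [folklore] -/
theorem okP_encV (n : ℕ) (x a : List Bool) (st : MState) :
    okP n (encV x a st) = [poolOk n (nthF 1 a) (nthF 2 a) st.pool] := by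
  match n with
  | 0 => rfl
  | 1 => rfl
  | 2 => rfl
  | 3 => simp [okP, poolOk]
  | 4 => rw [okP, andFn_apply (memP_encV _ _ _ _) (memP_encV _ _ _ _)]; simp [poolOk]
  | n + 5 => rw [okP, andFn_apply (memP_encV _ _ _ _) (memP_encV _ _ _ _)]; simp [poolOk]

/-- `outP n` computes `poolOut n`. [folklore] -/
theorem outP_encV (n : ℕ) (x a : List Bool) (st : MState) :
    outP n (encV x a st) = poolOut n (nthF 1 a) (nthF 2 a) := by
  match n with
  | 0 => simp [outP, poolOut]
  | 1 => rfl
  | 2 => rfl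
  | 3 => simp [outP, poolOut]
  | 4 => simp [outP, poolOut]
  | n + 5 => simp [outP, poolOut]

/-- `premsFn ps` computes the premise checks. [folklore] -/
theorem premsFn_encV (x a : List Bool) (st : MState) : ∀ ps : List (PropForm ℕ),
    premsFn ps (encV x a st) =
      [ps.all fun p => decide (sfill (sv (nthF 1 a) (nthF 2 a) (nthF 3 a)) p ∈ st.lines)]
  | [] => rfl
  | p :: ps => by
    have h1 : memL (fillFn p ∘ srecF) (encV x a st) =
        [decide (sfill (sv (nthF 1 a) (nthF 2 a) (nthF 3 a)) p ∈ st.lines)] := by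
      rw [memL_encV, fillFn_srecF_encV]
    rw [premsFn, andFn_apply h1 (premsFn_encV x a st ps)]
    simp

/-- `okR r` computes `ruleOk r`. [folklore] -/
theorem okR_encV (r : FregeRule) (x a : List Bool) (st : MState) :
    okR r (encV x a st) = [ruleOk r (sv (nthF 1 a) (nthF 2 a) (nthF 3 a)) st.lines st.pool] := by
  rw [okR, andFn_apply (premsFn_encV x a st _)
    (andFn_apply (memP_encV _ _ _ _) (andFn_apply (memP_encV _ _ _ _) (memP_encV _ _ _ _)))]
  simp [ruleOk, sv]

/-- `outR r` computes the instantiated conclusion. [folklore] -/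
theorem outR_encV (r : FregeRule) (x a : List Bool) (st : MState) :
    outR r (encV x a st) = sfill (sv (nthF 1 a) (nthF 2 a) (nthF 3 a)) r.conclusion :=
  fillFn_srecF_encV x a st _

/-! ### Dispatch on the kind -/

/-- The update of a rule item, by the rule found (failure if none). [folklore] -/
noncomputable def updRule : Option FregeRule → (List Bool → List Bool)
  | some r => updLine (okR r) (outR r)
  | none => updFail

/-- The update of kind `n`. [folklore] -/
noncomputable def updKind (n : ℕ) : List Bool → List Bool :=
  if n < 6 then updPool (okP n) (outP n) else updRule textbookFrege.rules[n - 6]?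

/-- `updRule o ∈ FP`. [folklore] -/
theorem updRule_mem_FP : ∀ o, updRule o ∈ FP
  | some r => updLine_mem_FP (okR_mem_FP r) (outR_mem_FP r)
  | none => updFail_mem_FP

/-- `updKind n ∈ FP`. [folklore] -/
theorem updKind_mem_FP (n : ℕ) : updKind n ∈ FP := by
  unfold updKind
  split_ifs
  · exact updPool_mem_FP (okP_mem_FP n) (outP_mem_FP n)
  · exact updRule_mem_FP _

/-- **The update of kind `n` is `applyKind n` of the model.** [folklore] -/
theorem updKind_encV (n : ℕ) (x a : List Bool) (st : MState) :
    updKind n (encV x a st) = encA (applyKind n (nthF 1 a) (nthF 2 a) (nthF 3 a) st) := by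
  by_cases hn : n < 6
  · rw [updKind, if_pos hn, applyKind, if_pos hn, updPool_encV x a st (okP_encV n x a st), outP_encV]
  · rw [updKind, if_neg hn]
    cases hr : textbookFrege.rules[n - 6]? with
    | none =>
      simp only [updRule, applyKind, if_neg hn, hr]
      exact updFail_encV x a st
    | some r =>
      simp only [updRule, applyKind, if_neg hn, hr]
      rw [updLine_encV x a st (okR_encV r x a st), outR_encV]

/-- The test "the item has kind `n`". [folklore] -/
noncomputable def kindEq (n : ℕ) : List Bool → List Bool := eqConstFn kindF (tag n)

/-- The dispatch chain over the kinds `ns`, defaulting to failure. [folklore] -/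
noncomputable def chain (ns : List ℕ) : List Bool → List Bool :=
  ns.foldr (fun n acc => iteFn (kindEq n) (updKind n) acc) updFail

/-- `chain ns ∈ FP`. [folklore] -/
theorem chain_mem_FP : ∀ ns, chain ns ∈ FP
  | [] => updFail_mem_FP
  | n :: ns => iteFn_mem_FP (eqConstFn_mem_FP kindF_mem_FP _) (updKind_mem_FP n) (chain_mem_FP ns)

/-- **The chain selects the update of the first matching kind**, on every input. [folklore] -/
theorem chain_apply (ns : List ℕ) (v : List Bool) :
    chain ns v = match ns.find? (fun n => decide (tag n = kindF v)) with
      | some n => updKind n v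
      | none => updFail v := by
  induction ns with
  | nil => rfl
  | cons n ns ih =>
    change iteFn (kindEq n) (updKind n) (chain ns) v = _
    rw [kindEq, iteFn_apply (eqConstFn_apply kindF (tag n) v), List.find?_cons]
    by_cases h : kindF v = tag n
    · simp [h]
    · have h' : ¬ tag n = kindF v := fun h'' => h h''.symm
      simp [h, h', ih]

/-- **The step of the fold**: dispatch on the kind of the item. [cite: CookReckhow1979, §1 (closing remark)] -/
noncomputable def stepA : List Bool → List Bool := chain (List.range numKinds)

/-- `stepA ∈ FP`. [folklore] -/
theorem stepA_mem_FP : stepA ∈ FP := chain_mem_FP _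

/-- The chain on a found kind. [folklore] -/
theorem chain_of_find_some {ns : List ℕ} {v : List Bool} {n : ℕ}
    (h : ns.find? (fun n => decide (tag n = kindF v)) = some n) : chain ns v = updKind n v := by
  rw [chain_apply, h]

/-- The chain when no kind is found. [folklore] -/
theorem chain_of_find_none {ns : List ℕ} {v : List Bool}
    (h : ns.find? (fun n => decide (tag n = kindF v)) = none) : chain ns v = updFail v := by
  rw [chain_apply, h]

/-- The model step on a found kind. [folklore] -/
theorem stepModel_of_kindOf_some {kind : List Bool} {n : ℕ} (h : kindOf kind = some n)
    (a b c : List Bool) (st : MState) : stepModel kind a b c st = applyKind n a b c st := by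
  simp [stepModel, h]

/-- The model step when no kind is found. [folklore] -/
theorem stepModel_of_kindOf_none {kind : List Bool} (h : kindOf kind = none)
    (a b c : List Bool) (st : MState) : stepModel kind a b c st = ⟨false, st.lines, st.pool⟩ := by
  simp [stepModel, h]

/-- **The step is the step of the model.** [folklore] -/
theorem stepA_encV (x a : List Bool) (st : MState) :
    stepA (encV x a st) = encA (stepModel (nthF 0 a) (nthF 1 a) (nthF 2 a) (nthF 3 a) st) := by
  have hk : (List.range numKinds).find? (fun n => decide (tag n = kindF (encV x a st))) =
      kindOf (nthF 0 a) := by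
    rw [kindF_encV]; rfl
  cases h : kindOf (nthF 0 a) with
  | none =>
    rw [stepModel_of_kindOf_none h, stepA, chain_of_find_none (hk.trans h)]
    exact updFail_encV x a st
  | some n =>
    rw [stepModel_of_kindOf_some h, stepA, chain_of_find_some (hk.trans h)]
    exact updKind_encV n x a st

/-- The item read as a quadruple of strings. [folklore] -/
def quad (a : List Bool) : Item := (nthF 0 a, nthF 1 a, nthF 2 a, nthF 3 a)

/-- An item string reads back as the item. [folklore] -/
@[simp] theorem quad_enc4 (it : Item) : quad (enc4 it) = it := by
  obtain ⟨k, a, b, c⟩ := it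
  simp [quad, enc4]

/-- **Folding the step runs the model.** [folklore] -/
theorem foldl_stepA (x : List Bool) : ∀ (l : List (List Bool)) (st : MState),
    l.foldl (fun acc a => stepA (boolPair x (boolPair a acc))) (encA st) = encA (run (l.map quad) st)
  | [], st => rfl
  | a :: l, st => by
    rw [List.foldl_cons, show boolPair x (boolPair a (encA st)) = encV x a st from rfl, stepA_encV,
      foldl_stepA x l]
    rfl

/-! ### Growth of the step -/

/-- The selected branch of the chain is a kind update or the failure update. [folklore] -/
theorem chain_cases (ns : List ℕ) (v : List Bool) :
    (∃ n, chain ns v = updKind n v) ∨ chain ns v = updFail v := by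
  rw [chain_apply]
  split
  · exact Or.inl ⟨_, rfl⟩
  · exact Or.inr rfl

/-- Lengths of the fields of the accumulator `sndPow 1 v` against its length. [folklore] -/
theorem accFields_le (v : List Bool) :
    2 * (nthF 2 v).length + 2 * (nthF 3 v).length + (sndPow 3 v).length ≤ (sndPow 1 v).length := by
  have h2 : 2 * (nthF 2 v).length + (sndPow 2 v).length ≤ (sndPow 1 v).length := by
    simpa using length_nthF_succ_add_sndPow_succ_le 1 v
  have h3 : 2 * (nthF 3 v).length + (sndPow 3 v).length ≤ (sndPow 2 v).length := by
    simpa using length_nthF_succ_add_sndPow_succ_le 2 v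
  omega

/-- The payloads are within the item: `2 (|a| + |b| + |c|) ≤ |srec| ≤ |item|`. [folklore] -/
theorem payloads_le (v : List Bool) :
    2 * ((aF v).length + (bF v).length + (cF v).length) ≤ (itemF v).length := by
  have h1 := two_mul_fields_le (srecF v)
  have h2 := length_fstF_sndF_le (itemF v)
  simp only [aF, bF, cF, srecF, Function.comp_apply] at h1 ⊢
  omega

/-- Growth of the failure update. [folklore] -/
theorem length_updFail_le (v : List Bool) : (updFail v).length ≤ (sndPow 1 v).length + 6 := by
  have h := accFields_le v
  simp only [updFail, length_fanoutFn, List.length_singleton]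
  omega

/-- Growth of a pool update with a short output. [folklore] -/
theorem length_updPool_le {ok out : List Bool → List Bool} (hok : OneBit ok) (v : List Bool) {d : ℕ}
    (hout : 2 * (out v).length ≤ 2 * (itemF v).length + d) :
    (updPool ok out v).length ≤ (sndPow 1 v).length + 2 * (itemF v).length + 8 + d := by
  have h := accFields_le v
  have hfl : (andFn flN ok v).length = 1 := (oneBit_andFn oneBit_flN hok).length_eq v
  simp only [updPool, length_fanoutFn, hfl]
  omega

/-- Growth of a line update with a short output. [folklore] -/
theorem length_updLine_le {ok out : List Bool → List Bool} (hok : OneBit ok) (v : List Bool) {d : ℕ}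
    (hout : 4 * (out v).length ≤ 4 * (itemF v).length + d) :
    (updLine ok out v).length ≤ (sndPow 1 v).length + 4 * (itemF v).length + 10 + d := by
  have h := accFields_le v
  have hfl : (andFn flN ok v).length = 1 := (oneBit_andFn oneBit_flN hok).length_eq v
  simp only [updLine, length_fanoutFn, hfl]
  omega

/-- Outputs of pool kinds are short. [folklore] -/
theorem length_outP_le (n : ℕ) (v : List Bool) : 2 * (outP n v).length ≤ 2 * (itemF v).length + 8 := by
  have hp := payloads_le v
  match n with
  | 0 => simp only [outP, Function.comp_apply, List.length_cons, length_fanoutFn, List.length_nil]; omega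
  | 1 => simp [outP]
  | 2 => simp [outP]
  | 3 => simp only [outP, Function.comp_apply, List.length_cons]; omega
  | 4 =>
    simp only [outP, Function.comp_apply, List.length_cons, fanoutFn_apply, appendFn_boolPair,
      List.length_append]; omega
  | n + 5 =>
    simp only [outP, Function.comp_apply, List.length_cons, fanoutFn_apply, appendFn_boolPair,
      List.length_append]; omega

/-- Outputs of rule kinds are short: `|sfill (sv a b c) D| ≤ 36 + 2 (|a| + |b| + |c|)`.
[folklore] -/
theorem length_outR_le {r : FregeRule} (hr : r ∈ textbookFrege.rules) (v : List Bool) :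
    4 * (outR r v).length ≤ 4 * (itemF v).length + 144 := by
  have hp := payloads_le v
  have h1 := length_sfill_le (sv (aF v) (bF v) (cF v)) r.conclusion
  have h2 := sum_varList_conclusion_le hr (sv (aF v) (bF v) (cF v))
  have h3 := size_conclusion_le hr
  have h4 : outR r v = sfill (sv (aF v) (bF v) (cF v)) r.conclusion := by
    simp [outR, fillFn_apply, aF, bF, cF]
  rw [h4]
  rw [show sv (aF v) (bF v) (cF v) 0 = aF v from rfl, show sv (aF v) (bF v) (cF v) 1 = bF v from rfl,
    show sv (aF v) (bF v) (cF v) 2 = cF v from rfl] at h2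
  omega

/-- Growth of a kind update. [folklore] -/
theorem length_updKind_le (n : ℕ) (v : List Bool) :
    (updKind n v).length ≤ (sndPow 1 v).length + 4 * (itemF v).length + 154 := by
  by_cases hn : n < 6
  · rw [updKind, if_pos hn]
    exact (length_updPool_le (oneBit_okP n) v (length_outP_le n v)).trans (by omega)
  · rw [updKind, if_neg hn]
    cases hr : textbookFrege.rules[n - 6]? with
    | none => exact (length_updFail_le v).trans (by omega)
    | some r => exact length_updLine_le (oneBit_okR r) v (length_outR_le (List.mem_of_getElem? hr) v)

/-- **Growth of the step** in the form `Brick.foldFn_mem_FP` consumes: the new accumulator is at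
most `4 |item| + 154` longer than the old one, on every input. [folklore] -/
theorem foldGrowth_stepA : FoldGrowth 154 stepA := by
  intro v
  have key : (stepA v).length ≤ (sndPow 1 v).length + 4 * (itemF v).length + 154 := by
    rcases chain_cases (List.range numKinds) v with ⟨n, hn⟩ | hn
    · rw [stepA, hn]; exact length_updKind_le n v
    · rw [stepA, hn]; exact (length_updFail_le v).trans (by omega)
  have e1 : sndPow 1 v = sndF (sndF v) := rfl
  have e2 : itemF v = fstF (sndF v) := rfl
  rw [e1, e2] at key
  nlinarith

/-! ### The verifier -/

/-- **The checker as a fold**: on input `z = ⟨w, c⟩`, fold the step over the items of `c` from the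
initial accumulator. [cite: AroraBarak2009, §1.3 (bounded loops)] -/
noncomputable def checkerF : List Bool → List Bool := foldFn stepA (fun _ => encA init)

/-- `checkerF ∈ FP`. [folklore] -/
theorem checkerF_mem_FP : checkerF ∈ FP := foldFn_mem_FP stepA_mem_FP (const_mem_FP _) foldGrowth_stepA

/-- **The checker runs the model** on the items read from the certificate. [folklore] -/
theorem checkerF_apply (z : List Bool) :
    checkerF z = encA (run ((decNil (sndF z)).map quad) init) := by
  rw [checkerF, foldFn_apply, foldl_stepA]

/-- The verdict: `ok`, and the most recent line equals the code carried by the input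
(`sndF w` for `w = ⟨1^{size}, code φ⟩ = encode φ`). [folklore] -/
noncomputable def fregeVerdictF : List Bool → List Bool :=
  andFn (eqConstFn (nthF 0 ∘ checkerF) [true]) (eqPairFn ∘ fanoutFn (fstF ∘ nthF 1 ∘ checkerF) (sndF ∘ fstF))

/-- `fregeVerdictF ∈ FP`. [folklore] -/
theorem fregeVerdictF_mem_FP : fregeVerdictF ∈ FP :=
  andFn_mem_FP (eqConstFn_mem_FP (comp_mem_FP (nthF_mem_FP 0) checkerF_mem_FP) _)
    (comp_mem_FP eqPairFn_mem_FP (fanoutFn_mem_FP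
      (comp_mem_FP fstF_mem_FP (comp_mem_FP (nthF_mem_FP 1) checkerF_mem_FP))
      (comp_mem_FP sndF_mem_FP fstF_mem_FP)))

/-- `fregeVerdictF` is one-bit. [folklore] -/
theorem oneBit_fregeVerdictF : OneBit fregeVerdictF :=
  oneBit_andFn (oneBit_eqConstFn _ _) (oneBit_eqPairFn.comp _)

/-- Value of the verdict. [folklore] -/
theorem fregeVerdictF_apply (z : List Bool) :
    fregeVerdictF z = [(run ((decNil (sndF z)).map quad) init).ok &&
      decide (fstF (encList (run ((decNil (sndF z)).map quad) init).lines) = sndF (fstF z))] := by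
  have h1 : eqConstFn (nthF 0 ∘ checkerF) [true] z = [(run ((decNil (sndF z)).map quad) init).ok] :=
    eqConstFn_true_bit _ _ _ (by simp [checkerF_apply, encA])
  have h2 : (eqPairFn ∘ fanoutFn (fstF ∘ nthF 1 ∘ checkerF) (sndF ∘ fstF)) z =
      [decide (fstF (encList (run ((decNil (sndF z)).map quad) init).lines) = sndF (fstF z))] := by
    simp [checkerF_apply, eqPairFn_boolPair]
  rw [fregeVerdictF, andFn_apply h1 h2]

/-- **The verifier** `V w c`. [cite: CookReckhow1979, §1 (closing remark)] -/
noncomputable def verifier (w c : List Bool) : Bool := decide (fregeVerdictF (boolPair w c) = [true])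

/-- **The verifier is polynomial time.** [cite: CookReckhow1979, §1 (p. 37: verification in polynomial time)] -/
theorem isPolyTimeVerifier_verifier : IsPolyTimeVerifier verifier := by
  refine fregeVerdictF_mem_FP.of_encode (fun p : List Bool × List Bool => boolPair p.1 p.2)
    (fun _ => rfl) fun p => ?_
  obtain ⟨w, c⟩ := p
  obtain ⟨b, hb⟩ := oneBit_fregeVerdictF (boolPair w c)
  simp only [id, Function.uncurry_apply_pair, verifier, hb]
  cases b <;> rfl

/-- The head string of a coded nonempty list. [folklore] -/
theorem fstF_encList_cons (L : List Bool) (l : List (List Bool)) : fstF (encList (L :: l)) = L := by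
  simp [encList]

/-- Codes of formulas are nonempty. [folklore] -/
theorem code_ne_nil (φ : PropForm ℕ) : φ.code ≠ [] := by
  cases φ <;> simp [PropForm.code]

/-- The second component of a codeword is the code. [folklore] -/
theorem sndF_encode (φ : PropForm ℕ) : sndF (encodingPropForm.encode φ) = φ.code := by
  change sndF (boolPair (unaryEncodeNat φ.size) φ.code) = φ.code
  simp

/-- **Soundness of the verifier**: an accepted certificate for the codeword of `φ` makes `φ`
a tautology (`isTautology_of_run`, applied to the items read from the certificate).
[cite: CookReckhow1979, §1 (closing remark) and §2 Def. 2.1–2.2] -/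
theorem verifier_sound (φ : PropForm ℕ) (c : List Bool)
    (h : verifier (encodingPropForm.encode φ) c = true) : φ.IsTautology := by
  simp only [verifier, decide_eq_true_eq, fregeVerdictF_apply, List.cons.injEq, and_true,
    Bool.and_eq_true, decide_eq_true_eq] at h
  obtain ⟨hok, hlast⟩ := h
  rw [fstF_boolPair, sndF_encode] at hlast
  set st := run ((decNil (sndF (boolPair (encodingPropForm.encode φ) c))).map quad) init with hst
  refine isTautology_of_run _ φ hok ?_
  rw [← hst]
  cases hl : st.lines with
  | nil =>
    rw [hl] at hlast
    exact absurd hlast.symm (by rw [encList_nil]; exact code_ne_nil φ)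
  | cons L rest => rw [hl, fstF_encList_cons] at hlast; simp [hlast]

/-- **Completeness of the verifier with polynomial overhead**: a `textbookFrege`-proof `π` of
`φ` yields an accepted certificate of length at most `100 (proofSize π + |encode φ| + 2)^4`
(`exists_certificate`). [cite: CookReckhow1979, §1 (closing remark), §2 Lemma 2.5] -/
theorem verifier_complete (φ : PropForm ℕ) (π : List (PropForm ℕ)) (h : textbookFrege.IsProofOf π φ) :
    ∃ c : List Bool, c.length ≤ (100 * (X + 2) ^ 4 : Polynomial ℕ).eval
        (proofSize π + (encodingPropForm.encode φ).length) ∧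
      verifier (encodingPropForm.encode φ) c = true := by
  obtain ⟨items, hok, hhead, hbits⟩ := exists_certificate h
  refine ⟨cert items, ?_, ?_⟩
  · rw [length_cert]
    simpa [eval_mul, eval_pow, eval_add, eval_X] using hbits
  · have hz : sndF (boolPair (encodingPropForm.encode φ) (cert items)) = cert items := by simp
    simp only [verifier, fregeVerdictF_apply, decide_eq_true_eq]
    rw [hz, cert, decNil_encList, List.map_map, fstF_boolPair, sndF_encode]
    have hq : (items.map (quad ∘ enc4)) = items := by
      conv_rhs => rw [← List.map_id items]
      exact List.map_congr_left fun it _ => quad_enc4 it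
    rw [hq, hok]
    obtain ⟨rest, hl⟩ : ∃ rest, (run items init).lines = φ.code :: rest := by
      cases hl : (run items init).lines with
      | nil => rw [hl] at hhead; simp at hhead
      | cons L rest => rw [hl] at hhead; simp at hhead; exact ⟨rest, by rw [hhead]⟩
    rw [hl, fstF_encList_cons]
    simp

end FregeVerifier

end Literature.Computability.MetaComplexity
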